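import Summits.NavierStokesRegularity.FunctionalMining.TopEigDensityFrame
import HarnessLib

/-!
# FunctionalMining — Lemma L-λ, brick (ii) in an eigenframe: the size of the eigenvector derivative
# `|e′|² = ∑_{a≠a₀} (u_aᵀA′e)² / (μ − κ_a)²`, its bound under a spectral gap, and `|(e⊗e)′|² = 2|e′|²`

Search for candidate a priori estimates; no regularity claim. Cell `pub-nsfunc`, prove seat
(gen 25). Chart-free linear algebra along a line, in the vocabulary of `TopEigDensityFrame`
(`eigenpair_channel_eq_sum_frame`): a differentiable eigenpair `A(t)e(t) = μ(t)e(t)` with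
`|e(t)| = 1`, `A(t₀)` symmetric, and a complete orthogonal eigenframe `(u_a)` of `A(t₀)` with
`u_{a₀} = e(t₀)`, `u_a ⊥ e(t₀)` and `κ_a ≠ μ(t₀)` for `a ≠ a₀`. Then, with `A′`, `e′` the derivatives
at `t₀`:

* `norm_sq_deriv_eigenvector_eq_sum_frame` — **`|e′|² = ∑_{a ≠ a₀} (u_aᵀ A′ e)² / (μ − κ_a)²`**
  (first-order perturbation `(μ − κ_a)(u_a·e′) = u_a·A′e`, `e′ ⊥ e`, Parseval);
* `norm_sq_deriv_eigenvector_le_of_gap` — if `μ − κ_a ≥ γ > 0` for all `a ≠ a₀`: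
  `|e′|² ≤ γ⁻² ∑_{a ≠ a₀} (u_aᵀA′e)²`;
* `sum_sq_projDeriv_eq` — for a unit `e` and `e′ ⊥ e`: `∑ᵢⱼ (e′ᵢeⱼ + eᵢe′ⱼ)² = 2|e′|²`
  (the Frobenius norm of the derivative of the projector `e ⊗ e`).

These are the pointwise ingredients of step (ii) of the kernel plan for the dictionary's node
`TopEigGapCoerciveTwo η` (Proposition L-λ(η); prove seat HANDOFF GEN 25, DERIVATIVES §46.4): on the
gap class `λ₂ ≤ (1−η)λ₁` the projector field `P₁ = e₁⊗e₁` of the strain has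
`|∂ₖP₁|² = 2∑_{a≠1}(u_aᵀS(∂ₖv)e₁)²/(λ₁−κ_a)² ≤ 2(ηλ₁)⁻²|S(∂ₖv)e₁|²`. Nothing about the torus or
Navier–Stokes is used or claimed here. [ours; folklore — first-order perturbation theory]
-/

noncomputable section

open Filter Topology Matrix

namespace Summit.NavierStokesRegularity.FunctionalMining

namespace TopEig

variable {d : Type*} [Fintype d]

/-- **`|e′|² = ∑_{a ≠ a₀} (u_aᵀ A′ e)² / (μ − κ_a)²`** — the squared size of the derivative of a unit
eigenvector of a simple eigenvalue, in an eigenframe (hypotheses as in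
`eigenpair_channel_eq_sum_frame`). [ours; folklore] -/
theorem norm_sq_deriv_eigenvector_eq_sum_frame {ι : Type*} [Fintype ι] [DecidableEq ι]
    {A : ℝ → Matrix d d ℝ} {A' : Matrix d d ℝ} {e : ℝ → d → ℝ} {e' : d → ℝ} {μ : ℝ → ℝ} {t₀ : ℝ}
    (hA : ∀ i j, HasDerivAt (fun t => A t i j) (A' i j) t₀)
    (he : ∀ i, HasDerivAt (fun t => e t i) (e' i) t₀) (hsymm : (A t₀).IsSymm)
    (heig : ∀ᶠ t in 𝓝 t₀, A t *ᵥ e t = μ t • e t) (hunit : ∀ᶠ t in 𝓝 t₀, e t ⬝ᵥ e t = 1)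
    {u : ι → d → ℝ} {κ : ι → ℝ} {a₀ : ι} (hu : ∀ a, A t₀ *ᵥ u a = κ a • u a) (hu₀ : u a₀ = e t₀)
    (horth : ∀ a, a ≠ a₀ → u a ⬝ᵥ e t₀ = 0) (hgap : ∀ a, a ≠ a₀ → κ a ≠ μ t₀)
    (hspan : ∀ x : d → ℝ, x = ∑ a, (x ⬝ᵥ u a) • u a) :
    e' ⬝ᵥ e' = ∑ a ∈ Finset.univ.erase a₀, ((u a ⬝ᵥ (A' *ᵥ e t₀)) / (μ t₀ - κ a)) ^ 2 := by
  have hμ := hasDerivAt_eigenvalue_line hA he hsymm heig hunit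
  have hderiv := eigenEquation_deriv hA he hμ heig
  have h0 : e' ⬝ᵥ e t₀ = 0 := dotProduct_deriv_eq_zero_of_unit he hunit
  -- Parseval with `y = e′`
  rw [dotProduct_eq_sum_frame (hspan e') e', ← Finset.add_sum_erase _ _ (Finset.mem_univ a₀)]
  have hzero : (e' ⬝ᵥ u a₀) * (u a₀ ⬝ᵥ e') = 0 := by rw [hu₀, h0, zero_mul]
  rw [hzero, zero_add]
  refine Finset.sum_congr rfl fun a ha => ?_
  have hne : a ≠ a₀ := (Finset.mem_erase.1 ha).1
  have hc := frame_coeff_of_eigenEquation_deriv hsymm hderiv (hu a) (horth a hne)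
  have hgap' : μ t₀ - κ a ≠ 0 := sub_ne_zero.2 (Ne.symm (hgap a hne))
  have hcoef : e' ⬝ᵥ u a = (u a ⬝ᵥ (A' *ᵥ e t₀)) / (μ t₀ - κ a) := by
    rw [eq_div_iff hgap', dotProduct_comm]
    linarith [hc]
  rw [dotProduct_comm (u a) e', hcoef]
  ring

/-- **`|e′|² ≤ γ⁻² ∑_{a ≠ a₀} (u_aᵀA′e)²` under a spectral gap `μ − κ_a ≥ γ > 0` (`a ≠ a₀`).**
On the strain's top-gap class `λ₂ ≤ (1−η)λ₁` this is used with `γ = ηλ₁`. [ours] -/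
theorem norm_sq_deriv_eigenvector_le_of_gap {ι : Type*} [Fintype ι] [DecidableEq ι]
    {A : ℝ → Matrix d d ℝ} {A' : Matrix d d ℝ} {e : ℝ → d → ℝ} {e' : d → ℝ} {μ : ℝ → ℝ} {t₀ : ℝ}
    (hA : ∀ i j, HasDerivAt (fun t => A t i j) (A' i j) t₀)
    (he : ∀ i, HasDerivAt (fun t => e t i) (e' i) t₀) (hsymm : (A t₀).IsSymm)
    (heig : ∀ᶠ t in 𝓝 t₀, A t *ᵥ e t = μ t • e t) (hunit : ∀ᶠ t in 𝓝 t₀, e t ⬝ᵥ e t = 1)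
    {u : ι → d → ℝ} {κ : ι → ℝ} {a₀ : ι} (hu : ∀ a, A t₀ *ᵥ u a = κ a • u a) (hu₀ : u a₀ = e t₀)
    (horth : ∀ a, a ≠ a₀ → u a ⬝ᵥ e t₀ = 0)
    (hspan : ∀ x : d → ℝ, x = ∑ a, (x ⬝ᵥ u a) • u a)
    {γ : ℝ} (hγ : 0 < γ) (hgapγ : ∀ a, a ≠ a₀ → γ ≤ μ t₀ - κ a) :
    e' ⬝ᵥ e' ≤ (γ ^ 2)⁻¹ * ∑ a ∈ Finset.univ.erase a₀, (u a ⬝ᵥ (A' *ᵥ e t₀)) ^ 2 := by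
  have hgap : ∀ a, a ≠ a₀ → κ a ≠ μ t₀ := fun a ha h => by
    have := hgapγ a ha; rw [h, sub_self] at this; linarith
  rw [norm_sq_deriv_eigenvector_eq_sum_frame hA he hsymm heig hunit hu hu₀ horth hgap hspan,
    Finset.mul_sum]
  refine Finset.sum_le_sum fun a ha => ?_
  have hne : a ≠ a₀ := (Finset.mem_erase.1 ha).1
  have hga := hgapγ a hne
  have hpos : 0 < μ t₀ - κ a := lt_of_lt_of_le hγ hga
  rw [div_pow, div_eq_mul_inv, mul_comm]
  refine mul_le_mul_of_nonneg_right ?_ (sq_nonneg _)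
  exact inv_anti₀ (pow_pos hγ 2) (pow_le_pow_left₀ hγ.le hga 2)

omit [Fintype d] in
/-- **`∑ᵢⱼ (e′ᵢ eⱼ + eᵢ e′ⱼ)² = 2|e′|²`** for a unit vector `e` and `e′ ⊥ e` — the squared Frobenius
norm of the derivative `e′⊗e + e⊗e′` of the rank-one projector `e⊗e` along a curve of unit vectors.
[ours; folklore] -/
theorem sum_sq_projDeriv_eq [Fintype d] {e e' : d → ℝ} (he1 : e ⬝ᵥ e = 1) (h0 : e' ⬝ᵥ e = 0) :
    ∑ i, ∑ j, (e' i * e j + e i * e' j) ^ 2 = 2 * (e' ⬝ᵥ e') := by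
  have hexp : ∀ i j, (e' i * e j + e i * e' j) ^ 2 =
      e' i * e' i * (e j * e j) + e i * e i * (e' j * e' j) + 2 * (e' i * e i) * (e j * e' j) := by
    intro i j; ring
  simp_rw [hexp, Finset.sum_add_distrib, ← Finset.mul_sum, ← Finset.sum_mul]
  have h1 : ∑ j, e j * e j = 1 := by simpa [dotProduct] using he1
  have h2 : ∑ i, e' i * e i = 0 := by simpa [dotProduct] using h0
  have h3 : ∑ j, e j * e' j = 0 := by simpa [dotProduct, mul_comm] using h0
  have h4 : ∑ i, e' i * e' i = e' ⬝ᵥ e' := by simp [dotProduct]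
  simp only [h1, h3, h4, mul_zero, mul_one, one_mul, add_zero]
  ring

end TopEig

end Summit.NavierStokesRegularity.FunctionalMining

end
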